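import Mathlib
import Literature.Analysis.Convexity.AnisotropicPerimeterLevelSets
import Literature.Analysis.Convexity.CavalieriSlices
import HarnessLib

/-!
# Super-level sets of piecewise-affine functions on polytopal complexes of `ℝ³`, IV:
# the piecewise-affine coarea formula and a good level

Topic `Literature/Analysis/Convexity`; namespace `Literature.Analysis.Convexity`.  Setting as in
`AnisotropicPerimeterLevelPieces.lean`: pairwise disjoint bounded open `H`-polytopes `Q_i` of
`EuclideanSpace ℝ (Fin 3)`, `f` continuous with `f = ⟪g_i, ·⟫ + b_i` on `closure Q_i`, a compact
convex body `K ∋ 0` (`h_K(ν) = sup_{y ∈ K} ⟪y, ν⟫`), and a base level `t₀` with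
`{f > t₀} ⊆ ⋃ closure Q_i`.

* `lintegral_anisotropicPerimeter_superlevel_eq` — **coarea, piecewise-affine case**:
  `∫⁻_{t > t₀} P_K({f > t}) dt = Σ_i h_K(-g_i) · |Q_i ∩ {f > t₀}|`
  (`= ∫_{f > t₀} h_K(-∇f)`; cells with `g_i = 0` contribute `h_K(0) = 0`).  The level-facet formula
  (III) holds for all but finitely many levels (`finite_setOf_levelPlane_eq_facetPlane`); the level
  facets of each cell integrate to `‖g_i‖ · |Q_i ∩ {f > t₀}|` by Cavalieri
  (`lintegral_volume_prism_levelSet`), and `h_K(-g_i/‖g_i‖) ‖g_i‖ = h_K(-g_i)`.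
* `exists_level_anisotropicPerimeter_superlevel_le` — **a good level**: if `t₀ < t₁`, some
  `t ∈ (t₀, t₁)` has `(t₁ - t₀) · P_K({f > t}) ≤ Σ_i h_K(-g_i) · |Q_i ∩ {f > t₀}|`.
* measurability of the level-facet areas / of `t ↦ P_K({f > t})` (a.e.), support-function algebra.

[cite: EvansGariepy2015, §3.4.4 Thm 3.13 (i)–(ii) (∫ |∇f| = ∫ H^{n-1}({f = t}) dt and integration over
level sets) with §3.4 Thm 3.10 (coarea), here for piecewise-affine `f` and the anisotropic integrand;
Maggi2012, (20.2) p. 258 and Remark 20.3]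
-/

noncomputable section

namespace Literature.Analysis.Convexity

open _root_.MeasureTheory Set Filter
open scoped RealInnerProductSpace Topology ENNReal Pointwise
open Literature.MeasureTheory.Integral

/-! ### Support-function algebra -/

/-- Positive homogeneity of the support function in the direction:
`h_K(r ν) = r · h_K(ν)` for `r ≥ 0`. [cite: Rockafellar1970, §13 Thm 13.2 — plumbing] -/
theorem sSup_inner_image_smul_right (K : Set (EuclideanSpace ℝ (Fin 3)))
    (a : EuclideanSpace ℝ (Fin 3)) {r : ℝ} (hr : 0 ≤ r) :
    sSup ((fun y : EuclideanSpace ℝ (Fin 3) => ⟪y, r • a⟫) '' K) =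
      r * sSup ((fun y : EuclideanSpace ℝ (Fin 3) => ⟪y, a⟫) '' K) := by
  have himg : (fun y : EuclideanSpace ℝ (Fin 3) => ⟪y, r • a⟫) '' K =
      r • ((fun y : EuclideanSpace ℝ (Fin 3) => ⟪y, a⟫) '' K) := by
    rw [← Set.image_smul, Set.image_image]
    refine Set.image_congr fun y _ => ?_
    rw [real_inner_smul_right, smul_eq_mul]
  rw [himg, Real.sSup_smul_of_nonneg hr, smul_eq_mul]

/-- `h_K(0) = 0` for nonempty `K`. [cite: Rockafellar1970, §13 Thm 13.2 — plumbing] -/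
theorem sSup_inner_image_zero {K : Set (EuclideanSpace ℝ (Fin 3))} (hK : K.Nonempty) :
    sSup ((fun y : EuclideanSpace ℝ (Fin 3) => ⟪y, (0 : EuclideanSpace ℝ (Fin 3))⟫) '' K) = 0 := by
  have : (fun y : EuclideanSpace ℝ (Fin 3) => ⟪y, (0 : EuclideanSpace ℝ (Fin 3))⟫) '' K = {0} := by
    rw [show (fun y : EuclideanSpace ℝ (Fin 3) => ⟪y, (0 : EuclideanSpace ℝ (Fin 3))⟫) =
      fun _ => (0 : ℝ) from funext fun y => inner_zero_right y]
    exact hK.image_const 0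
  rw [this, csSup_singleton]

/-- `h_K(-g/‖g‖) · ‖g‖ = h_K(-g)`. [cite: Rockafellar1970, §13 Thm 13.2 — plumbing] -/
theorem sSup_inner_image_neg_unit_mul_norm (K : Set (EuclideanSpace ℝ (Fin 3)))
    (g : EuclideanSpace ℝ (Fin 3)) (hg : g ≠ 0) :
    sSup ((fun y : EuclideanSpace ℝ (Fin 3) => ⟪y, -(‖g‖⁻¹ • g)⟫) '' K) * ‖g‖ =
      sSup ((fun y : EuclideanSpace ℝ (Fin 3) => ⟪y, -g⟫) '' K) := by
  have hgn : 0 < ‖g‖ := norm_pos_iff.2 hg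
  have h : -g = ‖g‖ • (-(‖g‖⁻¹ • g)) := by
    rw [smul_neg, smul_smul, mul_inv_cancel₀ hgn.ne', one_smul]
  rw [h, sSup_inner_image_smul_right K _ hgn.le, mul_comm]

/-! ### General position holds for all but finitely many levels -/

/-- **Only finitely many levels are in special position**: the set of `t` for which some level
plane `{⟪g_i, ·⟫ + b_i = t}` (`g_i ≠ 0`) coincides with a constraint plane of `H_i` is finite (each
pair `(i, p)` pins down at most one `t`). [cite: EvansGariepy2015, §3.4.4 Thm 3.13 — plumbing] -/
theorem finite_setOf_levelPlane_eq_facetPlane {k : ℕ}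
    (H : Fin k → Finset (EuclideanSpace ℝ (Fin 3) × ℝ)) (g : Fin k → EuclideanSpace ℝ (Fin 3))
    (b : Fin k → ℝ) :
    {t : ℝ | ∃ i, g i ≠ 0 ∧ ∃ p ∈ H i,
      {x : EuclideanSpace ℝ (Fin 3) | ⟪g i, x⟫ + b i = t} = {x | ⟪p.1, x⟫ = p.2}}.Finite := by
  have hsub : {t : ℝ | ∃ i, g i ≠ 0 ∧ ∃ p ∈ H i,
      {x : EuclideanSpace ℝ (Fin 3) | ⟪g i, x⟫ + b i = t} = {x | ⟪p.1, x⟫ = p.2}} ⊆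
      ⋃ i ∈ (Finset.univ : Finset (Fin k)), ⋃ p ∈ H i, {t : ℝ | g i ≠ 0 ∧
        {x : EuclideanSpace ℝ (Fin 3) | ⟪g i, x⟫ + b i = t} = {x | ⟪p.1, x⟫ = p.2}} := by
    rintro t ⟨i, hi, p, hp, heq⟩
    exact Set.mem_biUnion (Finset.mem_univ i) (Set.mem_biUnion hp ⟨hi, heq⟩)
  refine Set.Finite.subset ?_ hsub
  refine Set.Finite.biUnion (Finset.finite_toSet _) fun i _ => ?_
  refine Set.Finite.biUnion (Finset.finite_toSet _) fun p _ => ?_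
  refine Set.Subsingleton.finite ?_
  rintro t₁ ⟨hg1, h1⟩ t₂ ⟨-, h2⟩
  -- the point `((t₁ - b i)/‖g i‖²) g i` of the first level plane lies in the second
  set x : EuclideanSpace ℝ (Fin 3) := ((t₁ - b i) / ‖g i‖ ^ 2) • g i with hx
  have hgn : (0 : ℝ) < ‖g i‖ ^ 2 := by positivity
  have hx1 : ⟪g i, x⟫ + b i = t₁ := by
    rw [hx, real_inner_smul_right, real_inner_self_eq_norm_sq]
    field_simp
    ring
  have hxm : x ∈ {x : EuclideanSpace ℝ (Fin 3) | ⟪g i, x⟫ + b i = t₂} := by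
    rw [h2, ← h1]; exact hx1
  have h' : ⟪g i, x⟫ + b i = t₂ := hxm
  rw [hx1] at h'
  exact h'

/-! ### Measurability of the level-facet areas -/

/-- **The level-facet area is a measurable function of the level.**  For a measurable `S` on which
`f = ⟪g, ·⟫ + b` (`g ≠ 0`), the volume of the unit prism over `S ∩ {f = t}` along `-g/‖g‖` is a
measurable function of `t` (it is a chart-slice area of `S`, `measurable_volume_chartSlice`).
[cite: EvansGariepy2015, §3.4.1 Lemma 3.5 (ii) (measurability of slice measures) — affine case] -/
theorem measurable_volume_prism_levelFacet {S : Set (EuclideanSpace ℝ (Fin 3))}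
    (hS : MeasurableSet S) (g : EuclideanSpace ℝ (Fin 3)) (hg : g ≠ 0) (b : ℝ)
    {f : EuclideanSpace ℝ (Fin 3) → ℝ} (hf : ∀ x ∈ S, f x = ⟪g, x⟫ + b) :
    Measurable fun t : ℝ => volume {x : EuclideanSpace ℝ (Fin 3) | ∃ y ∈ S ∩ {x | f x = t},
      ∃ τ ∈ Set.Icc (0 : ℝ) 1, x = y + τ • (-(‖g‖⁻¹ • g))} := by
  have hgn : 0 < ‖g‖ := norm_pos_iff.2 hg
  set a : EuclideanSpace ℝ (Fin 3) := -(‖g‖⁻¹ • g) with ha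
  have ha1 : ‖a‖ = 1 := by
    rw [ha, norm_neg, norm_smul, norm_inv, norm_norm, inv_mul_cancel₀ hgn.ne']
  obtain ⟨U, V, hU, hV, hUV, haU, haV⟩ := exists_orthonormal_pair_perp a
  -- the base point of the chart of the level plane `{f = t}`
  have hag : ∀ y : EuclideanSpace ℝ (Fin 3), ⟪a, y⟫ = -(‖g‖⁻¹ * ⟪g, y⟫) := fun y => by
    rw [ha, inner_neg_left, real_inner_smul_left]
  have hkey : ∀ t : ℝ, volume {x : EuclideanSpace ℝ (Fin 3) | ∃ y ∈ S ∩ {x | f x = t},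
      ∃ τ ∈ Set.Icc (0 : ℝ) 1, x = y + τ • a} =
      volume {y : ℝ × ℝ | (0 : EuclideanSpace ℝ (Fin 3)) + (‖g‖⁻¹ * (b - t)) • a + y.1 • U +
        y.2 • V ∈ S} := by
    intro t
    have hF : ∀ y ∈ S ∩ {x | f x = t}, ⟪a, y⟫ = ⟪a, (‖g‖⁻¹ * (b - t)) • a⟫ := by
      rintro y ⟨hyS, hyt⟩
      have hfy : ⟪g, y⟫ + b = t := by rw [← hf y hyS]; exact hyt
      rw [real_inner_smul_right, real_inner_self_eq_norm_sq, ha1, one_pow, mul_one, hag]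
      rw [show ⟪g, y⟫ = t - b by linarith]
      ring
    rw [volume_prism_eq_volume_chartPreimage ha1 hU hV hUV haU haV hF, zero_add]
    congr 1
    ext y
    simp only [Set.mem_setOf_eq, Set.mem_inter_iff]
    constructor
    · exact fun h => h.1
    · intro h
      refine ⟨h, ?_⟩
      rw [hf _ h]
      have hplane : ⟪a, (‖g‖⁻¹ * (b - t)) • a + y.1 • U + y.2 • V⟫ = ‖g‖⁻¹ * (b - t) :=
        inner_chart_base_eq U V a (‖g‖⁻¹ * (b - t)) ha1 haU haV y
      rw [hag] at hplane
      have h2 := congrArg (fun s => ‖g‖ * s) hplane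
      rw [← mul_assoc, mul_neg, mul_inv_cancel₀ hgn.ne', ← mul_assoc, mul_inv_cancel₀ hgn.ne']
        at h2
      linarith
  simp_rw [hkey]
  have hm := measurable_volume_chartSlice hS a U V 0
  exact hm.comp (measurable_const.mul (measurable_const.sub measurable_id))

/-- The unit prism over a bounded planar piece has finite volume.
[cite: Maggi2012, Remark 20.3 p. 258 — plumbing] -/
theorem volume_prism_ne_top_of_isBounded {F : Set (EuclideanSpace ℝ (Fin 3))}
    (hF : Bornology.IsBounded F) (a : EuclideanSpace ℝ (Fin 3)) (ha : ‖a‖ ≤ 1) :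
    volume {x : EuclideanSpace ℝ (Fin 3) | ∃ y ∈ F, ∃ τ ∈ Set.Icc (0 : ℝ) 1, x = y + τ • a} ≠ ⊤ := by
  obtain ⟨R, hR⟩ := hF.subset_closedBall (0 : EuclideanSpace ℝ (Fin 3))
  have hsub : {x : EuclideanSpace ℝ (Fin 3) | ∃ y ∈ F, ∃ τ ∈ Set.Icc (0 : ℝ) 1, x = y + τ • a} ⊆
      Metric.closedBall (0 : EuclideanSpace ℝ (Fin 3)) (R + 1) := by
    rintro x ⟨y, hy, τ, hτ, rfl⟩
    have hy' := hR hy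
    rw [Metric.mem_closedBall, dist_zero_right] at hy' ⊢
    calc ‖y + τ • a‖ ≤ ‖y‖ + ‖τ • a‖ := norm_add_le _ _
      _ ≤ R + 1 := by
        rw [norm_smul, Real.norm_eq_abs, abs_of_nonneg hτ.1]
        nlinarith [hτ.1, hτ.2, norm_nonneg a]
  exact (lt_of_le_of_lt (measure_mono hsub) measure_closedBall_lt_top).ne

/-! ### The piecewise-affine coarea formula -/

/-- **Cavalieri for the level facets of one cell, above a base level**: for a convex cell `Q` with
`f = ⟪g, ·⟫ + b` on `closure Q` (`g ≠ 0`),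
`∫⁻_{t > t₀} |prism over closure Q ∩ {f = t}| dt = ‖g‖ · |Q ∩ {f > t₀}|`.
[cite: EvansGariepy2015, §3.4.4 Thm 3.13 (i) (∫ |∇f| = ∫ H^{n-1}({f = t}) dt), affine case via
`lintegral_volume_prism_levelSet`] -/
theorem lintegral_Ioi_volume_prism_levelFacet {Q : Set (EuclideanSpace ℝ (Fin 3))}
    (hQc : Convex ℝ Q) (g : EuclideanSpace ℝ (Fin 3)) (hg : g ≠ 0) (b : ℝ)
    {f : EuclideanSpace ℝ (Fin 3) → ℝ} (hf : ∀ x ∈ closure Q, f x = ⟪g, x⟫ + b) (t₀ : ℝ) :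
    ∫⁻ t in Set.Ioi t₀, volume {x : EuclideanSpace ℝ (Fin 3) | ∃ y ∈ closure Q ∩ {x | f x = t},
        ∃ τ ∈ Set.Icc (0 : ℝ) 1, x = y + τ • (-(‖g‖⁻¹ • g))} =
      ENNReal.ofReal ‖g‖ * volume (Q ∩ {x | t₀ < f x}) := by
  have hgn : 0 < ‖g‖ := norm_pos_iff.2 hg
  set a : EuclideanSpace ℝ (Fin 3) := ‖g‖⁻¹ • g with ha
  have ha1 : ‖a‖ = 1 := by rw [ha, norm_smul, norm_inv, norm_norm, inv_mul_cancel₀ hgn.ne']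
  obtain ⟨U, V, hU, hV, hUV, haU, haV⟩ := exists_orthonormal_pair_perp a
  set S : Set (EuclideanSpace ℝ (Fin 3)) := closure Q ∩ {x | t₀ < ⟪g, x⟫ + b} with hS
  have hSm : MeasurableSet S :=
    isClosed_closure.measurableSet.inter
      (isOpen_lt continuous_const ((continuous_const.inner continuous_id).add continuous_const)).measurableSet
  have hlit := lintegral_volume_prism_levelSet hg b hSm
  rw [← lintegral_indicator measurableSet_Ioi]
  have hpt : ∀ t : ℝ, (Set.Ioi t₀).indicator (fun t => volume {x : EuclideanSpace ℝ (Fin 3) |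
      ∃ y ∈ closure Q ∩ {x | f x = t}, ∃ τ ∈ Set.Icc (0 : ℝ) 1, x = y + τ • (-(‖g‖⁻¹ • g))}) t =
      volume {x : EuclideanSpace ℝ (Fin 3) | ∃ y ∈ S ∩ {x | ⟪g, x⟫ + b = t},
        ∃ τ ∈ Set.Icc (0 : ℝ) 1, x = y + τ • (‖g‖⁻¹ • g)} := by
    intro t
    by_cases ht : t ∈ Set.Ioi t₀
    · rw [Set.indicator_of_mem ht]
      have ht' : t₀ < t := ht
      have hset : closure Q ∩ {x | f x = t} = S ∩ {x : EuclideanSpace ℝ (Fin 3) | ⟪g, x⟫ + b = t} := by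
        ext x
        simp only [Set.mem_inter_iff, Set.mem_setOf_eq, hS]
        constructor
        · rintro ⟨hx, hxt⟩
          rw [hf x hx] at hxt
          exact ⟨⟨hx, by linarith⟩, hxt⟩
        · rintro ⟨⟨hx, -⟩, hxt⟩
          exact ⟨hx, by rw [hf x hx]; exact hxt⟩
      rw [hset]
      have hF : ∀ y ∈ S ∩ {x : EuclideanSpace ℝ (Fin 3) | ⟪g, x⟫ + b = t},
          ⟪a, y⟫ = ⟪a, (‖g‖⁻¹ * (t - b)) • a⟫ := by
        rintro y ⟨-, hyt⟩
        simp only [Set.mem_setOf_eq] at hyt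
        rw [real_inner_smul_right, real_inner_self_eq_norm_sq, ha1, one_pow, mul_one, ha,
          real_inner_smul_left]
        congr 1
        linarith
      rw [show -(‖g‖⁻¹ • g) = -a from rfl]
      exact volume_prism_neg_eq ha1 hU hV hUV haU haV hF
    · rw [Set.indicator_of_notMem ht]
      have ht' : t ≤ t₀ := not_lt.1 ht
      have hempty : S ∩ {x : EuclideanSpace ℝ (Fin 3) | ⟪g, x⟫ + b = t} = ∅ := by
        ext x
        simp only [Set.mem_inter_iff, Set.mem_setOf_eq, hS, Set.mem_empty_iff_false, iff_false,
          not_and]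
        intro hx hxt
        linarith [hx.2]
      rw [hempty]
      simp
  rw [lintegral_congr hpt, hlit]
  congr 1
  have hQS : Q ∩ {x | t₀ < f x} = Q ∩ {x : EuclideanSpace ℝ (Fin 3) | t₀ < ⟪g, x⟫ + b} := by
    ext x
    simp only [Set.mem_inter_iff, Set.mem_setOf_eq]
    constructor
    · rintro ⟨hx, h⟩
      exact ⟨hx, by rwa [hf x (subset_closure hx)] at h⟩
    · rintro ⟨hx, h⟩
      exact ⟨hx, by rwa [hf x (subset_closure hx)]⟩
  rw [hQS]
  exact measure_congr ((closure_ae_eq_of_convex' hQc).inter (ae_eq_refl _))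

/-- **The level-facet formula holds for a.e. level above the base**, in the measurable form
`P_K({f > t}) = Σ_{i : g_i ≠ 0} ofReal h_K(-g_i/‖g_i‖) · |prism_i(t)|`.
[cite: EvansGariepy2015, §3.4.4 Thm 3.13; Maggi2012, Remark 20.3 p. 258] -/
theorem ae_restrict_Ioi_anisotropicPerimeter_superlevel_eq {k : ℕ}
    (H : Fin k → Finset (EuclideanSpace ℝ (Fin 3) × ℝ)) (Q : Fin k → Set (EuclideanSpace ℝ (Fin 3)))
    (hQ : ∀ i, Q i = ⋂ p ∈ H i, {x : EuclideanSpace ℝ (Fin 3) | ⟪p.1, x⟫ < p.2})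
    (hbd : ∀ i, Bornology.IsBounded (Q i)) (hdisj : ∀ i j, i ≠ j → Disjoint (Q i) (Q j))
    (g : Fin k → EuclideanSpace ℝ (Fin 3)) (b : Fin k → ℝ)
    {f : EuclideanSpace ℝ (Fin 3) → ℝ} (hfc : Continuous f)
    (hf : ∀ i, ∀ x ∈ closure (Q i), f x = ⟪g i, x⟫ + b i)
    {K : Set (EuclideanSpace ℝ (Fin 3))} (hKc : IsCompact K) (hK : Convex ℝ K)
    (hK0 : (0 : EuclideanSpace ℝ (Fin 3)) ∈ K)
    {t₀ : ℝ} (hcov : {x | t₀ < f x} ⊆ ⋃ i, closure (Q i)) :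
    ∀ᵐ t ∂(volume.restrict (Set.Ioi t₀)), anisotropicPerimeter K {x | t < f x} =
      ∑ i ∈ Finset.univ.filter (fun i => g i ≠ 0),
        ENNReal.ofReal (sSup ((fun y : EuclideanSpace ℝ (Fin 3) => ⟪y, -(‖g i‖⁻¹ • g i)⟫) '' K)) *
          volume {x : EuclideanSpace ℝ (Fin 3) | ∃ y ∈ closure (Q i) ∩ {x | f x = t},
            ∃ τ ∈ Set.Icc (0 : ℝ) 1, x = y + τ • (-(‖g i‖⁻¹ • g i))} := by
  classical
  have hpos : ∀ i, 0 ≤ sSup ((fun y : EuclideanSpace ℝ (Fin 3) => ⟪y, -(‖g i‖⁻¹ • g i)⟫) '' K) :=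
    fun i => sSup_inner_nonneg hKc hK0 _
  have hvfin : ∀ i t, volume {x : EuclideanSpace ℝ (Fin 3) | ∃ y ∈ closure (Q i) ∩ {x | f x = t},
      ∃ τ ∈ Set.Icc (0 : ℝ) 1, x = y + τ • (-(‖g i‖⁻¹ • g i))} ≠ ⊤ := by
    intro i t
    refine volume_prism_ne_top_of_isBounded ((hbd i).closure.subset Set.inter_subset_left) _ ?_
    by_cases hgi : g i = 0
    · simp [hgi]
    · rw [norm_neg, norm_smul, norm_inv, norm_norm, inv_mul_cancel₀ (norm_ne_zero_iff.2 hgi)]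
  have hbad := finite_setOf_levelPlane_eq_facetPlane H g b
  have h1 : ∀ᵐ t ∂(volume.restrict (Set.Ioi t₀)), t ∉ {t : ℝ | ∃ i, g i ≠ 0 ∧ ∃ p ∈ H i,
      {x : EuclideanSpace ℝ (Fin 3) | ⟪g i, x⟫ + b i = t} = {x | ⟪p.1, x⟫ = p.2}} :=
    ae_restrict_of_ae (hbad.countable.ae_notMem volume)
  have h2 : ∀ᵐ t ∂(volume.restrict (Set.Ioi t₀)), t ∈ Set.Ioi t₀ := ae_restrict_mem measurableSet_Ioi
  filter_upwards [h1, h2] with t ht1 ht2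
  have ht2' : t₀ < t := ht2
  have hcov' : {x | t < f x} ⊆ ⋃ i, closure (Q i) := fun x hx => hcov (lt_trans ht2' hx)
  have hgen : ∀ i, g i ≠ 0 → ∀ p ∈ H i,
      {x : EuclideanSpace ℝ (Fin 3) | ⟪g i, x⟫ + b i = t} ≠ {x | ⟪p.1, x⟫ = p.2} :=
    fun i hi p hp heq => ht1 ⟨i, hi, p, hp, heq⟩
  rw [anisotropicPerimeter_superlevel_eq_levelFacetSum H Q hQ hbd hdisj g b hfc hf hKc hK hK0 hcov'
    hgen, ENNReal.ofReal_sum_of_nonneg (fun i _ => mul_nonneg (hpos i) ENNReal.toReal_nonneg)]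
  refine Finset.sum_congr rfl fun i _ => ?_
  rw [ENNReal.ofReal_mul (hpos i), ENNReal.ofReal_toReal (hvfin i t)]

/-- The measurable majorant: `t ↦ Σ_{i : g_i ≠ 0} ofReal h_K(-g_i/‖g_i‖) · |prism_i(t)|` is
measurable. [cite: EvansGariepy2015, §3.4.1 Lemma 3.5 (ii) — plumbing] -/
theorem measurable_levelFacetSum {k : ℕ} (Q : Fin k → Set (EuclideanSpace ℝ (Fin 3)))
    (g : Fin k → EuclideanSpace ℝ (Fin 3)) (b : Fin k → ℝ)
    {f : EuclideanSpace ℝ (Fin 3) → ℝ} (hf : ∀ i, ∀ x ∈ closure (Q i), f x = ⟪g i, x⟫ + b i)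
    (K : Set (EuclideanSpace ℝ (Fin 3))) :
    Measurable fun t : ℝ => ∑ i ∈ Finset.univ.filter (fun i => g i ≠ 0),
      ENNReal.ofReal (sSup ((fun y : EuclideanSpace ℝ (Fin 3) => ⟪y, -(‖g i‖⁻¹ • g i)⟫) '' K)) *
        volume {x : EuclideanSpace ℝ (Fin 3) | ∃ y ∈ closure (Q i) ∩ {x | f x = t},
          ∃ τ ∈ Set.Icc (0 : ℝ) 1, x = y + τ • (-(‖g i‖⁻¹ • g i))} := by
  classical
  refine Finset.measurable_sum _ fun i hi => ?_
  exact (measurable_volume_prism_levelFacet isClosed_closure.measurableSet (g i)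
    (Finset.mem_filter.1 hi).2 (b i) (hf i)).const_mul _

/-- **`t ↦ P_K({f > t})` is a.e.-measurable above the base level** (it agrees a.e. with the
measurable level-facet sum). [cite: EvansGariepy2015, §3.4.4 Thm 3.13 — plumbing] -/
theorem aemeasurable_anisotropicPerimeter_superlevel {k : ℕ}
    (H : Fin k → Finset (EuclideanSpace ℝ (Fin 3) × ℝ)) (Q : Fin k → Set (EuclideanSpace ℝ (Fin 3)))
    (hQ : ∀ i, Q i = ⋂ p ∈ H i, {x : EuclideanSpace ℝ (Fin 3) | ⟪p.1, x⟫ < p.2})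
    (hbd : ∀ i, Bornology.IsBounded (Q i)) (hdisj : ∀ i j, i ≠ j → Disjoint (Q i) (Q j))
    (g : Fin k → EuclideanSpace ℝ (Fin 3)) (b : Fin k → ℝ)
    {f : EuclideanSpace ℝ (Fin 3) → ℝ} (hfc : Continuous f)
    (hf : ∀ i, ∀ x ∈ closure (Q i), f x = ⟪g i, x⟫ + b i)
    {K : Set (EuclideanSpace ℝ (Fin 3))} (hKc : IsCompact K) (hK : Convex ℝ K)
    (hK0 : (0 : EuclideanSpace ℝ (Fin 3)) ∈ K)
    {t₀ : ℝ} (hcov : {x | t₀ < f x} ⊆ ⋃ i, closure (Q i)) :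
    AEMeasurable (fun t : ℝ => anisotropicPerimeter K {x | t < f x}) (volume.restrict (Set.Ioi t₀)) :=
  ((measurable_levelFacetSum Q g b hf K).aemeasurable).congr
    ((ae_restrict_Ioi_anisotropicPerimeter_superlevel_eq H Q hQ hbd hdisj g b hfc hf hKc hK hK0
      hcov).mono fun _ ht => ht.symm)

/-- **Coarea formula, piecewise-affine case, anisotropic integrand.**  For pairwise disjoint bounded
open `H`-polytopes `Q_i`, `f` continuous with `f = ⟪g_i, ·⟫ + b_i` on `closure Q_i`, a compact convex
`K ∋ 0` and a base level with `{f > t₀} ⊆ ⋃ closure Q_i`: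
`∫⁻_{t > t₀} P_K({f > t}) dt = Σ_i h_K(-g_i) · |Q_i ∩ {f > t₀}|` (`= ∫_{f > t₀} h_K(-∇f) dx`).
[cite: EvansGariepy2015, §3.4.4 Thm 3.13 (i) with §3.4 Thm 3.10 (coarea formula), piecewise-affine
case; Maggi2012, (20.2) p. 258 and Remark 20.3] -/
theorem lintegral_anisotropicPerimeter_superlevel_eq {k : ℕ}
    (H : Fin k → Finset (EuclideanSpace ℝ (Fin 3) × ℝ)) (Q : Fin k → Set (EuclideanSpace ℝ (Fin 3)))
    (hQ : ∀ i, Q i = ⋂ p ∈ H i, {x : EuclideanSpace ℝ (Fin 3) | ⟪p.1, x⟫ < p.2})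
    (hbd : ∀ i, Bornology.IsBounded (Q i)) (hdisj : ∀ i j, i ≠ j → Disjoint (Q i) (Q j))
    (g : Fin k → EuclideanSpace ℝ (Fin 3)) (b : Fin k → ℝ)
    {f : EuclideanSpace ℝ (Fin 3) → ℝ} (hfc : Continuous f)
    (hf : ∀ i, ∀ x ∈ closure (Q i), f x = ⟪g i, x⟫ + b i)
    {K : Set (EuclideanSpace ℝ (Fin 3))} (hKc : IsCompact K) (hK : Convex ℝ K)
    (hK0 : (0 : EuclideanSpace ℝ (Fin 3)) ∈ K)
    {t₀ : ℝ} (hcov : {x | t₀ < f x} ⊆ ⋃ i, closure (Q i)) :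
    ∫⁻ t in Set.Ioi t₀, anisotropicPerimeter K {x | t < f x} =
      ∑ i, ENNReal.ofReal (sSup ((fun y : EuclideanSpace ℝ (Fin 3) => ⟪y, -g i⟫) '' K)) *
        volume (Q i ∩ {x | t₀ < f x}) := by
  classical
  have hpos : ∀ i, 0 ≤ sSup ((fun y : EuclideanSpace ℝ (Fin 3) => ⟪y, -(‖g i‖⁻¹ • g i)⟫) '' K) :=
    fun i => sSup_inner_nonneg hKc hK0 _
  have hQc : ∀ i, Convex ℝ (Q i) := fun i => by rw [hQ i]; exact convex_openHPolytope (H i)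
  rw [lintegral_congr_ae (ae_restrict_Ioi_anisotropicPerimeter_superlevel_eq H Q hQ hbd hdisj g b hfc
    hf hKc hK hK0 hcov)]
  have hvm : ∀ i ∈ Finset.univ.filter (fun i => g i ≠ 0), Measurable fun t : ℝ =>
      volume {x : EuclideanSpace ℝ (Fin 3) | ∃ y ∈ closure (Q i) ∩ {x | f x = t},
        ∃ τ ∈ Set.Icc (0 : ℝ) 1, x = y + τ • (-(‖g i‖⁻¹ • g i))} := fun i hi =>
    measurable_volume_prism_levelFacet isClosed_closure.measurableSet (g i) (Finset.mem_filter.1 hi).2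
      (b i) (hf i)
  rw [lintegral_finsetSum _ fun i hi => (hvm i hi).const_mul _]
  have hcell : ∀ i ∈ Finset.univ.filter (fun i => g i ≠ 0),
      ∫⁻ t in Set.Ioi t₀, ENNReal.ofReal (sSup ((fun y : EuclideanSpace ℝ (Fin 3) =>
        ⟪y, -(‖g i‖⁻¹ • g i)⟫) '' K)) *
        volume {x : EuclideanSpace ℝ (Fin 3) | ∃ y ∈ closure (Q i) ∩ {x | f x = t},
          ∃ τ ∈ Set.Icc (0 : ℝ) 1, x = y + τ • (-(‖g i‖⁻¹ • g i))} =
      ENNReal.ofReal (sSup ((fun y : EuclideanSpace ℝ (Fin 3) => ⟪y, -g i⟫) '' K)) *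
        volume (Q i ∩ {x | t₀ < f x}) := by
    intro i hi
    have hgi : g i ≠ 0 := (Finset.mem_filter.1 hi).2
    rw [lintegral_const_mul _ (hvm i hi), lintegral_Ioi_volume_prism_levelFacet (hQc i) (g i) hgi
      (b i) (hf i) t₀, ← mul_assoc, ← ENNReal.ofReal_mul (hpos i),
      sSup_inner_image_neg_unit_mul_norm K (g i) hgi]
  rw [Finset.sum_congr rfl hcell]
  refine Finset.sum_subset (Finset.filter_subset _ _) fun i _ hi => ?_
  have hgi : g i = 0 := by simpa using hi
  rw [hgi, neg_zero, sSup_inner_image_zero ⟨0, hK0⟩, ENNReal.ofReal_zero, zero_mul]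

/-- **A good level.**  Under the hypotheses of `lintegral_anisotropicPerimeter_superlevel_eq` and
`t₀ < t₁`, some level `t ∈ (t₀, t₁)` satisfies
`(t₁ - t₀) · P_K({f > t}) ≤ Σ_i h_K(-g_i) · |Q_i ∩ {f > t₀}|`
(a level whose super-level set has perimeter at most the average over `(t₀, t₁)`).
[cite: EvansGariepy2015, §3.4.4 Thm 3.13 (ii) (integration over level sets) — the averaging step] -/
theorem exists_level_anisotropicPerimeter_superlevel_le {k : ℕ}
    (H : Fin k → Finset (EuclideanSpace ℝ (Fin 3) × ℝ)) (Q : Fin k → Set (EuclideanSpace ℝ (Fin 3)))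
    (hQ : ∀ i, Q i = ⋂ p ∈ H i, {x : EuclideanSpace ℝ (Fin 3) | ⟪p.1, x⟫ < p.2})
    (hbd : ∀ i, Bornology.IsBounded (Q i)) (hdisj : ∀ i j, i ≠ j → Disjoint (Q i) (Q j))
    (g : Fin k → EuclideanSpace ℝ (Fin 3)) (b : Fin k → ℝ)
    {f : EuclideanSpace ℝ (Fin 3) → ℝ} (hfc : Continuous f)
    (hf : ∀ i, ∀ x ∈ closure (Q i), f x = ⟪g i, x⟫ + b i)
    {K : Set (EuclideanSpace ℝ (Fin 3))} (hKc : IsCompact K) (hK : Convex ℝ K)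
    (hK0 : (0 : EuclideanSpace ℝ (Fin 3)) ∈ K)
    {t₀ t₁ : ℝ} (ht : t₀ < t₁) (hcov : {x | t₀ < f x} ⊆ ⋃ i, closure (Q i)) :
    ∃ t ∈ Set.Ioo t₀ t₁, ENNReal.ofReal (t₁ - t₀) * anisotropicPerimeter K {x | t < f x} ≤
      ∑ i, ENNReal.ofReal (sSup ((fun y : EuclideanSpace ℝ (Fin 3) => ⟪y, -g i⟫) '' K)) *
        volume (Q i ∩ {x | t₀ < f x}) := by
  classical
  set R : ℝ≥0∞ := ∑ i, ENNReal.ofReal (sSup ((fun y : EuclideanSpace ℝ (Fin 3) => ⟪y, -g i⟫) '' K)) *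
    volume (Q i ∩ {x | t₀ < f x}) with hR
  have hRfin : R ≠ ⊤ := by
    refine ENNReal.sum_ne_top.2 fun i _ => ENNReal.mul_ne_top ENNReal.ofReal_ne_top ?_
    exact ((hbd i).subset Set.inter_subset_left).measure_lt_top.ne
  have hδ0 : ENNReal.ofReal (t₁ - t₀) ≠ 0 := by
    rw [← pos_iff_ne_zero, ENNReal.ofReal_pos]; linarith
  have hδt : ENNReal.ofReal (t₁ - t₀) ≠ ⊤ := ENNReal.ofReal_ne_top
  set C : ℝ≥0∞ := R / ENNReal.ofReal (t₁ - t₀) with hC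
  have hCfin : C ≠ ⊤ := ENNReal.div_ne_top hRfin hδ0
  have hPae : AEMeasurable (fun t : ℝ => anisotropicPerimeter K {x | t < f x})
      (volume.restrict (Set.Ioo t₀ t₁)) :=
    (aemeasurable_anisotropicPerimeter_superlevel H Q hQ hbd hdisj g b hfc hf hKc hK hK0 hcov).mono_measure
      (Measure.restrict_mono Set.Ioo_subset_Ioi_self le_rfl)
  have hint : ∫⁻ t in Set.Ioo t₀ t₁, anisotropicPerimeter K {x | t < f x} ≤
      C * ENNReal.ofReal (t₁ - t₀) := by
    calc ∫⁻ t in Set.Ioo t₀ t₁, anisotropicPerimeter K {x | t < f x}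
        ≤ ∫⁻ t in Set.Ioi t₀, anisotropicPerimeter K {x | t < f x} :=
          lintegral_mono_set Set.Ioo_subset_Ioi_self
      _ = R := lintegral_anisotropicPerimeter_superlevel_eq H Q hQ hbd hdisj g b hfc hf hKc hK hK0 hcov
      _ = C * ENNReal.ofReal (t₁ - t₀) := (ENNReal.div_mul_cancel hδ0 hδt).symm
  obtain ⟨t, htI, hPt⟩ := exists_mem_Ioo_le_of_lintegral_le ht hCfin hPae hint
  refine ⟨t, htI, ?_⟩
  calc ENNReal.ofReal (t₁ - t₀) * anisotropicPerimeter K {x | t < f x}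
      ≤ ENNReal.ofReal (t₁ - t₀) * C := by gcongr
    _ = R := ENNReal.mul_div_cancel hδ0 hδt

end Literature.Analysis.Convexity

end
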